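import Summits.AnomalousDissipation.AnomalousDissipation.Theorems.MarginalStabilityChainStrainedLayerLawSumRuleLine
import Literature.Analysis.FluidPDE.StretchedLayerShearTails

/-!
# Crux `MarginalStabilityChain.StrainedLayerLaw` (stmt-AnomalousDissipation-3007), line `strain-work-sum-rule`:
# CONDITIONAL closure of the hygiene stub `stub_bareClassTails` under the recommended class repair

Support file (`--supports stmt-AnomalousDissipation-3007`; registered sub-goal `bareClassTails_of_hasShearLayerTails`).
The only stub of the line that is not landed besides the crux's own dynamics (`stub_concentrationFloor`) is the
hygiene stub `stub_bareClassTails`: every member of the crux's BARE class with locally finite dissipation has uniform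
exponential shear tails on compact time intervals. In the bare class this is open both ways (worker W3's audit,
item evidence 2026-08-16T16:06Z: explicit parallel ghosts show the bare class is non-unique; finite dissipation
excludes them; a proof needs weak–strong uniqueness plus existence of the tailed solution, neither in the tree).
Both line leads recommend the SAME route-level repair: append the physical side condition
`Literature.Analysis.FluidPDE.StretchedLayer.HasShearLayerTails u v` (landed, p113456; it implies the energy class
`HasLayerEnergyTails`, under which the sibling line's period rigidity is landed) to item 3007's hypothesis list.
This file records, kernel-checked, what the stub becomes then:

* `expTails_of_hasShearLayerTails` — shear-layer tails give the line's `ExpTails (Icc a b)` for `0 < a ≤ b`;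
* `bareClassTails_of_hasShearLayerTails` — the statement of `stub_bareClassTails` with `HasShearLayerTails u v`
  added as a hypothesis (registered sub-goal; the class membership, the admissibility of `θ` and the finiteness of
  the dissipation are then not even used).

No facts are asserted. Companion of `…VelocityRigidityEnergy.lean` (p95051), the sibling line's conditional closure.
-/

-- `Summit.<Summit>.<Problem>` is the tree's mandated summit-side namespace (CONVENTIONS §2); for this
-- single-conjunct summit the two coincide, so the duplicate is deliberate.
set_option linter.dupNamespace false

noncomputable section

open scoped Topology ENNReal
open Filter Set Function MeasureTheory

namespace Summit.AnomalousDissipation.AnomalousDissipation.Theorems.StrainedLayerLaw.StrainWorkSumRule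

open Literature.Analysis.FluidPDE Literature.Analysis.FluidPDE.StretchedLayer

/-- **Shear-layer tails imply the line's uniform exponential shear tails** `ExpTails (Icc a b) u v` on every compact
`[a, b] ⊂ (0, ∞)`: unpack `HasShearLayerTails.bounds_Icc` (one pair `C′, k′` on `[a, b]` bounding the shear quantity,
`v`, the gradient, the Laplacians and the time derivatives) and note that for `t > 0` the one-sided `dT (Ioi 0)` is
`deriv` (`dT_of_isOpen`). [folklore] -/
theorem expTails_of_hasShearLayerTails {u v : ℝ → ℝ → ℝ → ℝ} (h : HasShearLayerTails u v) {a b : ℝ}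
    (ha : 0 < a) (hab : a ≤ b) : ExpTails (Icc a b) u v := by
  obtain ⟨C', k', hk', hb⟩ := h.bounds_Icc ha hab
  refine ⟨C', k', hk', fun t ht => ?_⟩
  have ht0 : t ∈ Ioi (0 : ℝ) := ha.trans_le ht.1
  refine ⟨fun x y => ⟨(hb t ht x y).1, (hb t ht x y).2.1, (hb t ht x y).2.2.1, (hb t ht x y).2.2.2.1⟩,
    fun x y => ?_⟩
  rw [dT_of_isOpen isOpen_Ioi u ht0, dT_of_isOpen isOpen_Ioi v ht0]
  exact (hb t ht x y).2.2.2.2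

/-- **What `stub_bareClassTails` becomes after the recommended class repair (registered sub-goal).** Its statement
with `HasShearLayerTails u v` added to the hypotheses holds by repackaging (`expTails_of_hasShearLayerTails`); the
class, the admissibility of `θ` and the finiteness of the dissipation are not used. [folklore] -/
theorem bareClassTails_of_hasShearLayerTails : ∀ (ν L : ℝ), 0 < ν → 0 < L → ∀ (θ₁ θ₂ : ℝ → ℝ → ℝ),
    IsAdmissible L θ₁ θ₂ → ∀ (u v p : ℝ → ℝ → ℝ → ℝ), InCruxClass ν L θ₁ θ₂ u v p →
      HasShearLayerTails u v →
      (∀ T : ℝ, 0 < T → ∫⁻ t in Ioc 0 T, layerDissipation ν L (u t) (v t) ≠ ∞) →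
        ∀ a b : ℝ, 0 < a → a < b → ExpTails (Icc a b) u v :=
  fun _ν _L _hν _hL _θ₁ _θ₂ _hθ _u _v _p _hcl htails _hfin _a _b ha hab =>
    expTails_of_hasShearLayerTails htails ha hab.le

end Summit.AnomalousDissipation.AnomalousDissipation.Theorems.StrainedLayerLaw.StrainWorkSumRule

end
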